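import Summits.QuantumFields.YangMills.Theorems.BalabanLadderNTReferenceTorusTwoPoint
import Summits.QuantumFields.YangMills.Theorems.BalabanLadderNTReferenceTorusThreePoint
import HarnessLib

/-!
# Crux `NT` (stmt-QuantumFields-19353): reference-state transfer, XVII — the MINIMAL form: arbitrary oscillation
# bounds on ONE engine-chosen femto cube per coupling, floors with the matching margin on ONE torus per coupling

Helper file (`--supports stmt-QuantumFields-19353`) of the fleet lead prover of crux `NT` (unit `ym-spine-19353-p1`,
g4).  Skeleton of record v4T «periodic-reference» (`stub_refpkgT : RefPkgT`, owner RULING R60) asks the oscillation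
ceilings E1/E2/E3-osc on EVERY femto cube with the decay laws `d⁻⁴`, `d⁻⁴(1+r)⁻⁴`, `d⁻⁴(1+min sep)⁻⁸`.  The
composition (files VII–IX) reads them only on the ONE transfer cube per coupling, at the sites of the support box, and
only through the resulting numbers.  This file states exactly that minimum, with the decay laws replaced by ARBITRARY
engine-supplied bounds:

* `q2_floor_of_oneCube` — given `v` (support in the ball of radius `σ`), `ε`, and for every `β ≥ β₅` an origin-centred
  cube `P_β` of lattice radius `R β ≥ ⌈σ/aβ⌉₊ + 1`, femto (`(2Rβ+1)·aβ ≤ ℓ`), inside a torus `2L₀(β)+1`, a one-point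
  oscillation bound `k β` and a two-point oscillation bound `w β x y` for the `P_β`-kernel data at the sites of the
  support box, and the floor `ε + Σ_{x,y} |θv(aβx)||v(aβy)| (2 (k β)² + w β x y) ≤ Q2_{β,L₀(β),aβ}(θv, v)`: then
  `Q2_{β,L,aβ}(θv,v) ≥ ε` on every torus with `aβ·L ≥ ℓ + 1`, `β` large;
* `q3_floor_of_oneCube` — the three-point twin (per-triple margin `2 (k w_yz + k w_xz + k w_xy + k³) + ω₃`, unsigned);
* `lowerBounds_of_oneCube` — both clauses ⇒ `LowerBounds G r a` (`Λ₅ = ℓ + 1`).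

E1/E2/E3-osc with their decay laws are ONE way to produce `k, w, ω₃` (files VII–IX); a Bałaban-type engine may supply
whatever its expansion yields on its own cube.  No `d⁻⁴` law, no collar `κ`, no reference radius is part of the target.
-/

set_option autoImplicit false

noncomputable section

open scoped SchwartzMap
open MeasureTheory Filter Topology
open Literature.MathematicalPhysics.QuantumFieldTheory Literature.MathematicalPhysics.QuantumLattice
open Literature.Probability.LatticeModels
open Summit.QuantumFields.YangMills.Cruxes.OSLegsFromFemtoAndGap.DlrCollarTransfer

namespace Summit.QuantumFields.YangMills.Cruxes.NT.Reference

section OneCube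

variable (G : Type) [Group G] [TopologicalSpace G] [IsTopologicalGroup G] [CompactSpace G]
  [MeasurableSpace G] [BorelSpace G] (r : LatticeRep G)

/-- **Scales of the one-cube transfer.**  At spacing `α ≤ 1/4`, a radius `R ≥ ⌈σ/α⌉₊ + 1` with `(2R+1) α ≤ ℓ`
and a torus with `ℓ + 1 ≤ α L`: the support box of radius `⌈σ/α⌉₊` sits at depth `≥ 1` in the origin-centred cube of
radius `R`, which fits in the torus (`(2R+1) + 3 ≤ 2L+1`), and the support box lies in the box of radius `L`. [folklore] -/
theorem oneCube_scales {α σ ℓ : ℝ} (hα : 0 < α) (h4 : α ≤ 1 / 4) {R L : ℕ} (hR : ⌈σ / α⌉₊ + 1 ≤ R)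
    (hfem : ((2 * R + 1 : ℕ) : ℝ) * α ≤ ℓ) (hL : ℓ + 1 ≤ α * L) :
    2 * R + 1 + 3 ≤ 2 * L + 1 ∧ ⌈σ / α⌉₊ ≤ L ∧
    ∀ x ∈ box 4 ⌈σ / α⌉₊, 1 ≤ depth (fun _ => -(R : ℤ)) (2 * R + 1) x := by
  have hαinv : 4 ≤ 1 / α := by
    rw [le_div_iff₀ hα]; linarith [mul_le_mul_of_nonneg_left h4 (by norm_num : (0:ℝ) ≤ 4)]
  have hRr : (2 * (R : ℝ) + 1) * α ≤ ℓ := by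
    have e : ((2 * R + 1 : ℕ) : ℝ) = 2 * (R : ℝ) + 1 := by push_cast; ring
    rw [← e]; exact hfem
  have hLr : ℓ / α + 1 / α ≤ (L : ℝ) := by
    rw [← add_div, div_le_iff₀ hα]; linarith
  have h2R : 2 * (R : ℝ) + 1 ≤ ℓ / α := by rw [le_div_iff₀ hα]; exact hRr
  have hRL : (R : ℝ) + 2 ≤ (L : ℝ) := by linarith
  have hRL' : R + 2 ≤ L := by exact_mod_cast hRL
  refine ⟨by omega, by omega, fun x hx => ?_⟩
  have hd := le_depth_origin x R (abs_cast_le_of_mem_box hx)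
  have hR' : ((⌈σ / α⌉₊ : ℕ) : ℝ) + 1 ≤ (R : ℝ) := by exact_mod_cast hR
  have h1 : (1 : ℝ) ≤ (depth (fun _ => -(R : ℤ)) (2 * R + 1) x : ℝ) := by linarith
  exact_mod_cast h1

/-- **Two-point floor on every torus from ONE engine-chosen cube and ONE torus per coupling, arbitrary oscillation
bounds.**  See the module docstring. [folklore] -/
theorem q2_floor_of_oneCube (a : ℝ → ℝ) (ha₀ : ∀ β, 0 < a β) (ha : Tendsto a atTop (𝓝 0)) {σ ℓ : ℝ}
    (v : 𝓢(EuclideanSpace ℝ (Fin 4), ℝ)) (ε β₅ : ℝ) (R L₀ : ℝ → ℕ) (k : ℝ → ℝ)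
    (w : ℝ → (Fin 4 → ℤ) → (Fin 4 → ℤ) → ℝ)
    (hvσ : tsupport (v : EuclideanSpace ℝ (Fin 4) → ℝ) ⊆ Metric.closedBall 0 σ)
    (H : ∀ β : ℝ, β₅ ≤ β → ⌈σ / a β⌉₊ + 1 ≤ R β ∧ ((2 * R β + 1 : ℕ) : ℝ) * a β ≤ ℓ ∧ ℓ + 1 ≤ a β * L₀ β ∧
      (∀ (ζ ζ' : LGConfig 4 G) (x : Fin 4 → ℤ), x ∈ box 4 ⌈σ / a β⌉₊ →
        |kerE G r β (fun _ => -(R β : ℤ)) (2 * R β + 1) ζ (dens G r x) -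
          kerE G r β (fun _ => -(R β : ℤ)) (2 * R β + 1) ζ' (dens G r x)| ≤ k β) ∧
      (∀ (ζ ζ' : LGConfig 4 G) (x y : Fin 4 → ℤ), x ∈ box 4 ⌈σ / a β⌉₊ → y ∈ box 4 ⌈σ / a β⌉₊ →
        |kerCov G r β (fun _ => -(R β : ℤ)) (2 * R β + 1) ζ (dens G r x) (dens G r y) -
          kerCov G r β (fun _ => -(R β : ℤ)) (2 * R β + 1) ζ' (dens G r x) (dens G r y)| ≤ w β x y) ∧
      ε + ∑ x ∈ box 4 ⌈σ / a β⌉₊, ∑ y ∈ box 4 ⌈σ / a β⌉₊,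
          |thetaTest 4 v (a β • siteToE x)| * |v (a β • siteToE y)| * (2 * k β * k β + w β x y) ≤
        Q2 G r β (L₀ β) (a β) (thetaTest 4 v) v) :
    ∃ β₅' : ℝ, ∀ β : ℝ, β₅' ≤ β → ∀ L : ℕ, ℓ + 1 ≤ a β * L → ε ≤ Q2 G r β L (a β) (thetaTest 4 v) v := by
  obtain ⟨βa, Ha⟩ := eventually_le_of_tendsto ha (by norm_num : (0 : ℝ) < 1 / 4)
  refine ⟨max β₅ βa, fun β hβ L hL => ?_⟩
  have hβ₅ : β₅ ≤ β := le_trans (le_max_left _ _) hβ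
  have hα : 0 < a β := ha₀ β
  have h4 : a β ≤ 1 / 4 := Ha β (le_trans (le_max_right _ _) hβ)
  obtain ⟨hR, hfem, hL₀, H1, H2, HR⟩ := H β hβ₅
  obtain ⟨hLL, hNL, hdep⟩ := oneCube_scales hα h4 hR hfem hL
  obtain ⟨hLL₀, hNL₀, -⟩ := oneCube_scales hα h4 hR hfem hL₀
  set N := ⌈σ / a β⌉₊ with hN
  have hθ0 : ∀ x, x ∉ box 4 N → thetaTest 4 v (a β • siteToE x) = 0 := fun x hx =>
    thetaTest_smul_siteToE_eq_zero hα hvσ hx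
  have hw0 : ∀ y, y ∉ box 4 N → v (a β • siteToE y) = 0 := fun y hy =>
    apply_smul_siteToE_eq_zero hα hvσ hy
  have hpair : ∀ x ∈ box 4 N, ∀ y ∈ box 4 N,
      |(torusE G r β L (fun U => dens G r x U * dens G r y U) - torusE G r β L (dens G r x) * torusE G r β L (dens G r y))
        - (torusE G r β (L₀ β) (fun U => dens G r x U * dens G r y U) -
            torusE G r β (L₀ β) (dens G r x) * torusE G r β (L₀ β) (dens G r y))| ≤
      2 * k β * k β + w β x y :=
    fun x hx y hy => abs_torusCov_dens_sub_torusCov_dens_le G r β _ _ L (L₀ β) hLL hLL₀ (hdep x hx) (hdep y hy)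
      (fun ζ ζ' => H1 ζ ζ' x hx) (fun ζ ζ' => H1 ζ ζ' y hy) (fun ζ ζ' => H2 ζ ζ' x y hx hy)
  have eQ : ∀ M : ℕ, N ≤ M → Q2 G r β M (a β) (thetaTest 4 v) v = ∑ x ∈ box 4 N, ∑ y ∈ box 4 N,
      thetaTest 4 v (a β • siteToE x) * v (a β • siteToE y) *
        (torusE G r β M (fun U => dens G r x U * dens G r y U) -
          torusE G r β M (dens G r x) * torusE G r β M (dens G r y)) := fun M hM => by
    unfold Q2
    exact sum_box₂_eq hM _ (fun x hx y => by rw [hθ0 x hx]; ring) (fun y hy x => by rw [hw0 y hy]; ring)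
  have hsum := sum_sum_sub_le_of_abs_sub_le (box 4 N) (fun x => thetaTest 4 v (a β • siteToE x))
    (fun y => v (a β • siteToE y))
    (fun x y => torusE G r β L (fun U => dens G r x U * dens G r y U) -
      torusE G r β L (dens G r x) * torusE G r β L (dens G r y))
    (fun x y => torusE G r β (L₀ β) (fun U => dens G r x U * dens G r y U) -
      torusE G r β (L₀ β) (dens G r x) * torusE G r β (L₀ β) (dens G r y))
    (w β) (2 * k β * k β) hpair
  rw [← sum_sum_mul_add] at hsum
  rw [eQ (L₀ β) hNL₀] at HR
  rw [eQ L hNL]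
  linarith [hsum, HR]

/-- **Three-point floor on every torus from ONE engine-chosen cube and ONE torus per coupling, arbitrary
oscillation bounds** (per-triple margin `2 (k w_yz + k w_xz + k w_xy + k³) + ω₃`; no sign of the cumulant). [folklore] -/
theorem q3_floor_of_oneCube (a : ℝ → ℝ) (ha₀ : ∀ β, 0 < a β) (ha : Tendsto a atTop (𝓝 0)) {σ ℓ : ℝ}
    (f g h : 𝓢(EuclideanSpace ℝ (Fin 4), ℝ)) (ε β₅ : ℝ) (R L₀ : ℝ → ℕ) (k : ℝ → ℝ)
    (w : ℝ → (Fin 4 → ℤ) → (Fin 4 → ℤ) → ℝ) (ω₃ : ℝ → (Fin 4 → ℤ) → (Fin 4 → ℤ) → (Fin 4 → ℤ) → ℝ)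
    (hfσ : tsupport (f : EuclideanSpace ℝ (Fin 4) → ℝ) ⊆ Metric.closedBall 0 σ)
    (hgσ : tsupport (g : EuclideanSpace ℝ (Fin 4) → ℝ) ⊆ Metric.closedBall 0 σ)
    (hhσ : tsupport (h : EuclideanSpace ℝ (Fin 4) → ℝ) ⊆ Metric.closedBall 0 σ)
    (H : ∀ β : ℝ, β₅ ≤ β → ⌈σ / a β⌉₊ + 1 ≤ R β ∧ ((2 * R β + 1 : ℕ) : ℝ) * a β ≤ ℓ ∧ ℓ + 1 ≤ a β * L₀ β ∧
      (∀ (ζ ζ' : LGConfig 4 G) (x : Fin 4 → ℤ), x ∈ box 4 ⌈σ / a β⌉₊ →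
        |kerE G r β (fun _ => -(R β : ℤ)) (2 * R β + 1) ζ (dens G r x) -
          kerE G r β (fun _ => -(R β : ℤ)) (2 * R β + 1) ζ' (dens G r x)| ≤ k β) ∧
      (∀ (ζ ζ' : LGConfig 4 G) (x y : Fin 4 → ℤ), x ∈ box 4 ⌈σ / a β⌉₊ → y ∈ box 4 ⌈σ / a β⌉₊ →
        |kerCov G r β (fun _ => -(R β : ℤ)) (2 * R β + 1) ζ (dens G r x) (dens G r y) -
          kerCov G r β (fun _ => -(R β : ℤ)) (2 * R β + 1) ζ' (dens G r x) (dens G r y)| ≤ w β x y) ∧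
      (∀ (ζ ζ' : LGConfig 4 G) (x y z : Fin 4 → ℤ),
        x ∈ box 4 ⌈σ / a β⌉₊ → y ∈ box 4 ⌈σ / a β⌉₊ → z ∈ box 4 ⌈σ / a β⌉₊ →
        |kerK3 G r β (fun _ => -(R β : ℤ)) (2 * R β + 1) ζ x y z -
          kerK3 G r β (fun _ => -(R β : ℤ)) (2 * R β + 1) ζ' x y z| ≤ ω₃ β x y z) ∧
      ε + ∑ x ∈ box 4 ⌈σ / a β⌉₊, ∑ y ∈ box 4 ⌈σ / a β⌉₊, ∑ z ∈ box 4 ⌈σ / a β⌉₊,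
          |f (a β • siteToE x)| * |g (a β • siteToE y)| * |h (a β • siteToE z)| *
            (2 * (k β * w β y z + k β * w β x z + k β * w β x y + k β * k β * k β) + ω₃ β x y z) ≤
        |Q3 G r β (L₀ β) (a β) f g h|) :
    ∃ β₅' : ℝ, ∀ β : ℝ, β₅' ≤ β → ∀ L : ℕ, ℓ + 1 ≤ a β * L → ε ≤ |Q3 G r β L (a β) f g h| := by
  obtain ⟨βa, Ha⟩ := eventually_le_of_tendsto ha (by norm_num : (0 : ℝ) < 1 / 4)
  refine ⟨max β₅ βa, fun β hβ L hL => ?_⟩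
  have hβ₅ : β₅ ≤ β := le_trans (le_max_left _ _) hβ
  have hα : 0 < a β := ha₀ β
  have h4 : a β ≤ 1 / 4 := Ha β (le_trans (le_max_right _ _) hβ)
  obtain ⟨hR, hfem, hL₀, H1, H2, H3, HR⟩ := H β hβ₅
  obtain ⟨hLL, hNL, hdep⟩ := oneCube_scales hα h4 hR hfem hL
  obtain ⟨hLL₀, hNL₀, -⟩ := oneCube_scales hα h4 hR hfem hL₀
  set N := ⌈σ / a β⌉₊ with hN
  have hf0 : ∀ x, x ∉ box 4 N → f (a β • siteToE x) = 0 := fun x hx => apply_smul_siteToE_eq_zero hα hfσ hx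
  have hg0 : ∀ y, y ∉ box 4 N → g (a β • siteToE y) = 0 := fun y hy => apply_smul_siteToE_eq_zero hα hgσ hy
  have hh0 : ∀ z, z ∉ box 4 N → h (a β • siteToE z) = 0 := fun z hz => apply_smul_siteToE_eq_zero hα hhσ hz
  have htriple : ∀ x ∈ box 4 N, ∀ y ∈ box 4 N, ∀ z ∈ box 4 N,
      |torusK3 G r β L x y z - torusK3 G r β (L₀ β) x y z| ≤
      2 * (k β * w β y z + k β * w β x z + k β * w β x y + k β * k β * k β) + ω₃ β x y z :=
    fun x hx y hy z hz => abs_torusK3_sub_torusK3_le G r β _ _ L (L₀ β) hLL hLL₀ (hdep x hx) (hdep y hy) (hdep z hz)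
      (fun ζ ζ' => H1 ζ ζ' x hx) (fun ζ ζ' => H1 ζ ζ' y hy) (fun ζ ζ' => H1 ζ ζ' z hz)
      (fun ζ ζ' => H2 ζ ζ' y z hy hz) (fun ζ ζ' => H2 ζ ζ' x z hx hz) (fun ζ ζ' => H2 ζ ζ' x y hx hy)
      (fun ζ ζ' => H3 ζ ζ' x y z hx hy hz)
  have eQ : ∀ M : ℕ, N ≤ M → Q3 G r β M (a β) f g h = ∑ x ∈ box 4 N, ∑ y ∈ box 4 N, ∑ z ∈ box 4 N,
      f (a β • siteToE x) * g (a β • siteToE y) * h (a β • siteToE z) * torusK3 G r β M x y z := fun M hM => by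
    unfold Q3
    exact sum_box₃_eq hM _ (fun x hx y z => by rw [hf0 x hx]; ring) (fun y hy x z => by rw [hg0 y hy]; ring)
      (fun z hz x y => by rw [hh0 z hz]; ring)
  have hsum := abs_sum₃_sub_sum₃_le (box 4 N) (fun x => f (a β • siteToE x)) (fun y => g (a β • siteToE y))
    (fun z => h (a β • siteToE z)) (fun x y z => torusK3 G r β L x y z)
    (fun x y z => torusK3 G r β (L₀ β) x y z) _ htriple
  rw [eQ (L₀ β) hNL₀] at HR
  rw [eQ L hNL]
  have tri := abs_sub_abs_le_abs_sub
    (∑ x ∈ box 4 N, ∑ y ∈ box 4 N, ∑ z ∈ box 4 N,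
      f (a β • siteToE x) * g (a β • siteToE y) * h (a β • siteToE z) * torusK3 G r β (L₀ β) x y z)
    (∑ x ∈ box 4 N, ∑ y ∈ box 4 N, ∑ z ∈ box 4 N,
      f (a β • siteToE x) * g (a β • siteToE y) * h (a β • siteToE z) * torusK3 G r β L x y z)
  rw [abs_sub_comm] at hsum
  linarith [hsum, HR, tri]

end OneCube

end Summit.QuantumFields.YangMills.Cruxes.NT.Reference

end
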